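import Literature.NumberTheory.Automorphic.CuspidalMautnerGL2
import Literature.NumberTheory.Automorphic.SmoothedCuspForms
import Literature.NumberTheory.Automorphic.WhittakerCoeffCuspidal
import HarnessLib

/-!
# The orbit pairing `Λ_F(u) = ∫ F(h) u(h⁻¹ · x₀) dh` on `L²` of the automorphic quotient,
# its Howe–Moore decay along a split torus of `GL₂(K_v)`, and unfolding of Whittaker coefficients
# against test functions

Topic `NumberTheory/Automorphic`; namespace `Literature.NumberTheory.Automorphic`. A brick of the
local half of the printed proof of Arthur–Clozel (2.3) in rank `2` (named fact
`JacquetShalika1981_partialPairL_pole_of_eq_conj`, reduced by `PairLFunctionPolesEqConjFirstMoment`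
to the finiteness at `s = 1` of the bad-place part of the unfolded Rankin–Selberg integral;
Jacquet–Shalika, *Euler products I* (1981), §1 and Prop. (3.17)). The decay of the Kirillov functions
of a cusp form at a finite place `v` is obtained from Howe–Moore in **weak `L²` form**: Whittaker
values integrated against a test function `F ∈ C_c(GL_n(𝔸_K))` are a bounded linear functional of
the underlying `L²`-class, to which `CuspidalMautnerGL2.tendsto_inner_rightRegular_diagOne` applies.

* `orbitPairing F u = ∫ F(h) u(h⁻¹ • x₀) dh` (`= ∫ F · invQuot u`, `orbitPairing_eq_integral_invQuot`):
  the orbital smoothing of `u` by the complex weight `F` at the base point; it does not see null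
  modifications of `u` (`orbitPairing_congr_ae`), is additive and homogeneous, and bounded on `L²(μ)`
  (`exists_norm_orbitPairing_le`, from `SmoothedCuspForms.exists_norm_orbitalSmoothing_smul_le`);
  `orbitPairingCLM` is the resulting continuous linear functional.
* `CuspidalAutomorphicRepGL.tendsto_orbitPairing_rightRegular_diagOne` — **Howe–Moore, weak form**:
  for `u` in a cuspidal `Π ≤ L²(GL₂)` and `F ∈ C_c(GL₂(𝔸_K))`,
  `Λ_F(R(ι_v diag(t,1)) u) → 0` as `t → 0` in `K_v` (Riesz representation of `Λ_F` and
  `tendsto_inner_rightRegular_diagOne`). [cite: HoweMoore1979, Thm. 5.1 and Thm. 5.2]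
* `integral_mul_whittakerCoeff_eq` — **unfolding a Whittaker coefficient against a test function**:
  `∫_G F(g) W_φ(g) dg = ∫_G F̌(h) φ(h) dh` with
  `F̌(h) = whittakerTransform F h = (ν₀ 𝓕)⁻¹ ∫_𝓕 F(u⁻¹ h) conj ψ(u) dν₀(u)` (Fubini on `𝓕 × supp F`
  and left invariance of `dg`), for continuous `φ` and `F ∈ C_c` (Cogdell (2004), §1.1, the
  definition `W_φ(g) = ∫ φ(u g) ψ⁻¹(u) du`). [folklore]
-/

noncomputable section

open MeasureTheory Measure Set Filter Topology IsDedekindDomain NumberField Function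
open scoped ENNReal Pointwise InnerProductSpace MatrixGroups ComplexConjugate

namespace Literature.NumberTheory.Automorphic

/-! ### The orbit pairing -/

section Pairing

variable {n : ℕ} {K : Type} [Field K] [NumberField K]
  {μ : Measure (AdelicGroupData.gl n K).automorphicQuotient}
  [(AdelicGroupData.gl n K).IsAutomorphicMeasure μ]

attribute [local instance] adelicBorel borelSpace_adelic locallyCompactSpace_adelic
  secondCountableTopology_gl_adelic

/-- The **orbit pairing** `Λ_F(u) = ∫ F(h) u(h⁻¹ • x₀) dh` of a function `u` on the automorphic
quotient with a weight `F` on `GL_n(𝔸_K)` (Haar measure `adelicHaar`, base point `x₀`): the orbital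
smoothing `S_F u (x₀)`. [folklore] -/
def orbitPairing (F : (AdelicGroupData.gl n K).Adelic → ℂ)
    (u : (AdelicGroupData.gl n K).automorphicQuotient → ℂ) : ℂ :=
  orbitalSmoothing (adelicHaar n K) F u (basePoint n K)

omit [(AdelicGroupData.gl n K).IsAutomorphicMeasure μ] in
/-- `Λ_F(u) = ∫ F(h) (invQuot u)(h) dh`. [folklore] -/
theorem orbitPairing_eq_integral_invQuot (F : (AdelicGroupData.gl n K).Adelic → ℂ)
    (u : (AdelicGroupData.gl n K).automorphicQuotient → ℂ) :
    orbitPairing F u = ∫ h, F h * invQuot (AdelicGroupData.gl n K) u h ∂(adelicHaar n K) := by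
  unfold orbitPairing orbitalSmoothing
  congr 1 with h
  rw [smul_eq_mul, invQuot_apply, smul_basePoint]

/-- The orbit pairing does not see `μ`-null modifications of `u`. [folklore] -/
theorem orbitPairing_congr_ae (F : (AdelicGroupData.gl n K).Adelic → ℂ)
    {u u' : (AdelicGroupData.gl n K).automorphicQuotient → ℂ} (h : u =ᵐ[μ] u') :
    orbitPairing F u = orbitPairing F u' :=
  orbitalSmoothing_adelicHaar_congr_ae (μ := μ) F h _

/-- Additivity of the orbit pairing in `u` (integrable `u`, `F ∈ C_c`). [folklore] -/
theorem orbitPairing_add {F : (AdelicGroupData.gl n K).Adelic → ℂ} (hF : Continuous F)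
    (hFs : HasCompactSupport F) {u u' : (AdelicGroupData.gl n K).automorphicQuotient → ℂ}
    (hu : Integrable u μ) (hu' : Integrable u' μ) :
    orbitPairing F (u + u') = orbitPairing F u + orbitPairing F u' := by
  unfold orbitPairing orbitalSmoothing
  rw [← integral_add (integrable_smul_comp_inv_smul μ (adelicHaar n K)
      (isOpenMap_smul_basePoint n K) hF hFs hu)
    (integrable_smul_comp_inv_smul μ (adelicHaar n K) (isOpenMap_smul_basePoint n K) hF hFs hu')]
  congr 1 with g
  rw [Pi.add_apply, smul_add]

omit [(AdelicGroupData.gl n K).IsAutomorphicMeasure μ] in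
/-- Homogeneity of the orbit pairing in `u`. [folklore] -/
theorem orbitPairing_smul (F : (AdelicGroupData.gl n K).Adelic → ℂ) (c : ℂ)
    (u : (AdelicGroupData.gl n K).automorphicQuotient → ℂ) :
    orbitPairing F (c • u) = c * orbitPairing F u := by
  unfold orbitPairing orbitalSmoothing
  rw [← integral_const_mul]
  congr 1 with g
  simp only [Pi.smul_apply, smul_eq_mul]
  ring

/-- **The orbit pairing is bounded on `L²(μ)`**: `‖Λ_F(u)‖ ≤ C ‖u‖_{L²}` for `F ∈ C_c`. [folklore] -/
theorem exists_norm_orbitPairing_le {F : (AdelicGroupData.gl n K).Adelic → ℂ} (hF : Continuous F)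
    (hFs : HasCompactSupport F) :
    ∃ C : ℝ, 0 ≤ C ∧ ∀ u : (AdelicGroupData.gl n K).L2 μ,
      ‖orbitPairing F (u : (AdelicGroupData.gl n K).automorphicQuotient → ℂ)‖ ≤ C * ‖u‖ := by
  obtain ⟨C, hC0, hC⟩ := exists_norm_orbitalSmoothing_smul_le (E' := ℂ) μ (adelicHaar n K)
    (isOpenMap_smul_basePoint n K)
    (isCompact_singleton (x := (1 : (AdelicGroupData.gl n K).Adelic))) hF hFs
  refine ⟨C * (μ Set.univ).toReal ^ (1 / 2 : ℝ), by positivity, fun u => ?_⟩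
  have h1 := hC _ (Lp.stronglyMeasurable u) (integrable_coeFn_L2 μ u) 1 (Set.mem_singleton 1)
  rw [one_smul] at h1
  calc ‖orbitPairing F (u : (AdelicGroupData.gl n K).automorphicQuotient → ℂ)‖
      ≤ C * ∫ x, ‖(u : (AdelicGroupData.gl n K).automorphicQuotient → ℂ) x‖ ∂μ := h1
    _ ≤ C * ((μ Set.univ).toReal ^ (1 / 2 : ℝ) * ‖u‖) :=
        mul_le_mul_of_nonneg_left (integral_norm_le_measure_univ_rpow_mul_norm u) hC0
    _ = C * (μ Set.univ).toReal ^ (1 / 2 : ℝ) * ‖u‖ := (mul_assoc _ _ _).symm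

variable (μ) in
/-- The orbit pairing as a **continuous linear functional** on `L²(μ)`. [folklore] -/
def orbitPairingCLM {F : (AdelicGroupData.gl n K).Adelic → ℂ} (hF : Continuous F)
    (hFs : HasCompactSupport F) : (AdelicGroupData.gl n K).L2 μ →L[ℂ] ℂ :=
  LinearMap.mkContinuous
    { toFun := fun u => orbitPairing F (u : (AdelicGroupData.gl n K).automorphicQuotient → ℂ)
      map_add' := fun u u' => by
        rw [orbitPairing_congr_ae (μ := μ) F (Lp.coeFn_add u u'),
          orbitPairing_add (μ := μ) hF hFs (integrable_coeFn_L2 μ u) (integrable_coeFn_L2 μ u')]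
      map_smul' := fun c u => by
        rw [RingHom.id_apply, orbitPairing_congr_ae (μ := μ) F (Lp.coeFn_smul c u),
          orbitPairing_smul, smul_eq_mul] }
    (exists_norm_orbitPairing_le (μ := μ) hF hFs).choose
    (fun u => (exists_norm_orbitPairing_le (μ := μ) hF hFs).choose_spec.2 u)

/-- `orbitPairingCLM` acts as `orbitPairing`. [folklore] -/
@[simp]
theorem orbitPairingCLM_apply {F : (AdelicGroupData.gl n K).Adelic → ℂ} (hF : Continuous F)
    (hFs : HasCompactSupport F) (u : (AdelicGroupData.gl n K).L2 μ) :
    orbitPairingCLM μ hF hFs u =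
      orbitPairing F (u : (AdelicGroupData.gl n K).automorphicQuotient → ℂ) := rfl

/-- The orbit pairing of a right translate `R(g) u`: `Λ_F(R(g) u) = ∫ F(h) ũ((h g)⁻¹ • x₀) dh` for any
representative `ũ` of `u` (`(R(g) u)(x) = u(g⁻¹ • x)` a.e.). [folklore] -/
theorem orbitPairing_rightRegular (F : (AdelicGroupData.gl n K).Adelic → ℂ)
    (g : (AdelicGroupData.gl n K).Adelic) (u : (AdelicGroupData.gl n K).L2 μ)
    {ũ : (AdelicGroupData.gl n K).automorphicQuotient → ℂ}
    (hũ : (u : (AdelicGroupData.gl n K).automorphicQuotient → ℂ) =ᵐ[μ] ũ) :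
    orbitPairing F ((AdelicGroupData.rightRegular (AdelicGroupData.gl n K) μ g u :
        (AdelicGroupData.gl n K).L2 μ) : (AdelicGroupData.gl n K).automorphicQuotient → ℂ) =
      ∫ h, F h * invQuot (AdelicGroupData.gl n K) ũ (h * g) ∂(adelicHaar n K) := by
  have h1 : ((AdelicGroupData.rightRegular (AdelicGroupData.gl n K) μ g u :
        (AdelicGroupData.gl n K).L2 μ) : (AdelicGroupData.gl n K).automorphicQuotient → ℂ) =ᵐ[μ]
      fun x => ũ (g⁻¹ • x) :=
    (AdelicGroupData.rightRegular_apply_coeFn _ _ g u).trans (ae_eq_comp_smul hũ g⁻¹)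
  rw [orbitPairing_congr_ae (μ := μ) F h1, orbitPairing_eq_integral_invQuot]
  congr 1 with h

end Pairing

/-! ### Howe–Moore in weak form (GL₂, one finite place) -/

section GL2

variable {K : Type} [Field K] [NumberField K]
  {μ : Measure (AdelicGroupData.gl 2 K).automorphicQuotient}
  [(AdelicGroupData.gl 2 K).IsAutomorphicMeasure μ] (v : HeightOneSpectrum (𝓞 K))

attribute [local instance] adelicBorel borelSpace_adelic locallyCompactSpace_adelic
  secondCountableTopology_gl_adelic

/-- **Howe–Moore decay in weak form.** For `u` in a cuspidal `Π ≤ L²(GL₂(K) A \ GL₂(𝔸_K))` and a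
test function `F ∈ C_c(GL₂(𝔸_K))`, the orbit pairings `Λ_F(R(ι_v diag(t, 1)) u)` tend to `0` as
`t → 0` in `K_v` (Riesz: `Λ_F = ⟪w_F, ·⟫`, and `⟪R(ι_v diag(t,1)) u, w_F⟫ → 0` by
`tendsto_inner_rightRegular_diagOne`). [cite: HoweMoore1979, Thm. 5.1 and Thm. 5.2] -/
theorem CuspidalAutomorphicRepGL.tendsto_orbitPairing_rightRegular_diagOne
    (P : CuspidalAutomorphicRepGL 2 K μ) {u : (AdelicGroupData.gl 2 K).L2 μ} (huP : u ∈ P.1)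
    {F : (AdelicGroupData.gl 2 K).Adelic → ℂ} (hF : Continuous F) (hFs : HasCompactSupport F) :
    Tendsto (fun t : (v.adicCompletion K)ˣ => orbitPairing F
        ((AdelicGroupData.rightRegular (AdelicGroupData.gl 2 K) μ
          (GLn.toAdelic 2 K v (SL2Mautner.diagOne t)) u : (AdelicGroupData.gl 2 K).L2 μ) :
            (AdelicGroupData.gl 2 K).automorphicQuotient → ℂ))
      (comap ((↑) : (v.adicCompletion K)ˣ → v.adicCompletion K) (𝓝 0)) (𝓝 0) := by
  set Λ := orbitPairingCLM μ hF hFs with hΛdef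
  set w := (InnerProductSpace.toDual ℂ ((AdelicGroupData.gl 2 K).L2 μ)).symm Λ with hw
  have hΛ : ∀ x, Λ x = ⟪w, x⟫_ℂ := fun x => by
    rw [hw, InnerProductSpace.toDual_symm_apply]
  have h := P.tendsto_inner_rightRegular_diagOne v huP w
  have h2 : Tendsto (fun t : (v.adicCompletion K)ˣ =>
      conj ⟪(AdelicGroupData.rightRegular (AdelicGroupData.gl 2 K) μ
        (GLn.toAdelic 2 K v (SL2Mautner.diagOne t))) u, w⟫_ℂ)
      (comap ((↑) : (v.adicCompletion K)ˣ → v.adicCompletion K) (𝓝 0)) (𝓝 (conj 0)) :=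
    (Complex.continuous_conj.tendsto 0).comp h
  rw [map_zero] at h2
  refine h2.congr fun t => ?_
  rw [inner_conj_symm, ← hΛ, hΛdef, orbitPairingCLM_apply]

end GL2

/-! ### Unfolding a Whittaker coefficient against a test function -/

section WhittakerUnfold

variable {n : ℕ} {K : Type} [Field K] [NumberField K]

attribute [local instance] glAdeleBorel borelSpace_glAdele

/-- The **Whittaker transform** of a test function `F` on `GL_n(𝔸_K)`:
`F̌(h) = (ν₀ 𝓕)⁻¹ ∫_𝓕 F(u⁻¹ h) conj ψ(u) dν₀(u)`. [folklore] -/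
def whittakerTransform (ν₀ : Measure ↥(adelicUnipotent n K)) (𝓕 : Set ↥(adelicUnipotent n K))
    (ψ : AddChar (AdeleRing (𝓞 K) K) Circle) (F : GL (Fin n) (AdeleRing (𝓞 K) K) → ℂ)
    (h : GL (Fin n) (AdeleRing (𝓞 K) K)) : ℂ :=
  ((ν₀ 𝓕).toReal⁻¹ : ℝ) •
    ∫ u in 𝓕, F ((u : GL (Fin n) (AdeleRing (𝓞 K) K))⁻¹ * h) * conj (whittakerCharFun ψ u) ∂ν₀

/-- `‖conj ψ(u)‖ = 1`. [folklore] -/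
theorem norm_conj_whittakerCharFun (ψ : AddChar (AdeleRing (𝓞 K) K) Circle)
    (u : ↥(adelicUnipotent n K)) : ‖conj (whittakerCharFun ψ u)‖ = 1 := by
  rw [RCLike.norm_conj, whittakerCharFun_apply, Circle.norm_coe]

/-- **Unfolding a Whittaker coefficient against a test function**: for `F ∈ C_c(GL_n(𝔸_K))`,
continuous `φ`, a left-invariant measure `dg` and a measurable `𝓕 ⊆ N_n(𝔸_K)` of compact closure
and finite measure,
`∫ F(g) W_φ(g) dg = ∫ F̌(h) φ(h) dh`, `F̌ = whittakerTransform ν₀ 𝓕 ψ F`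
(`W_φ(g) = (ν₀ 𝓕)⁻¹ ∫_𝓕 φ(u g) conj ψ(u)`; Fubini and `g ↦ u⁻¹ g`). [folklore] -/
theorem integral_mul_whittakerCoeff_eq [SecondCountableTopology (GL (Fin n) (AdeleRing (𝓞 K) K))]
    (νG : Measure (GL (Fin n) (AdeleRing (𝓞 K) K))) [νG.IsMulLeftInvariant] [SFinite νG]
    [IsFiniteMeasureOnCompacts νG]
    (ν₀ : Measure ↥(adelicUnipotent n K)) [SFinite ν₀] {𝓕 : Set ↥(adelicUnipotent n K)}
    (h𝓕m : MeasurableSet 𝓕) (h𝓕c : IsCompact (closure 𝓕)) (h𝓕f : ν₀ 𝓕 < ∞)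
    {ψ : AddChar (AdeleRing (𝓞 K) K) Circle} (hψ : Continuous ψ)
    {F : GL (Fin n) (AdeleRing (𝓞 K) K) → ℂ} (hF : Continuous F) (hFs : HasCompactSupport F)
    {φ : GL (Fin n) (AdeleRing (𝓞 K) K) → ℂ} (hφ : Continuous φ) :
    ∫ g, F g * whittakerCoeff ν₀ 𝓕 ψ φ g ∂νG = ∫ h, whittakerTransform ν₀ 𝓕 ψ F h * φ h ∂νG := by
  haveI : IsFiniteMeasure (ν₀.restrict 𝓕) := isFiniteMeasure_restrict.2 h𝓕f.ne
  set c : ℝ := (ν₀ 𝓕).toReal⁻¹ with hc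
  -- notation
  set χ : ↥(adelicUnipotent n K) → ℂ := fun u => conj (whittakerCharFun ψ u) with hχ
  have hχc : Continuous χ := Complex.continuous_conj.comp (continuous_whittakerCharFun hψ)
  have hχ1 : ∀ u, ‖χ u‖ = 1 := norm_conj_whittakerCharFun ψ
  have hcoe : Continuous fun u : ↥(adelicUnipotent n K) => (u : GL (Fin n) (AdeleRing (𝓞 K) K)) :=
    continuous_subtype_val
  -- compact sets carrying the integrands
  set D : Set (GL (Fin n) (AdeleRing (𝓞 K) K)) := tsupport F with hD
  have hDc : IsCompact D := hFs
  set C𝓕 : Set (GL (Fin n) (AdeleRing (𝓞 K) K)) :=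
    (fun u : ↥(adelicUnipotent n K) => (u : GL (Fin n) (AdeleRing (𝓞 K) K))) '' closure 𝓕 with hC𝓕
  have hC𝓕c : IsCompact C𝓕 := h𝓕c.image hcoe
  obtain ⟨MF, hMF⟩ := hF.bounded_above_of_compact_support hFs
  have hMF0 : 0 ≤ MF := (norm_nonneg _).trans (hMF 1)
  -- Step 1: `F g * W_φ(g) = c • ∫_𝓕 F g * (φ(u g) * χ u)`.
  have hstep1 : ∀ g, F g * whittakerCoeff ν₀ 𝓕 ψ φ g =
      (c : ℂ) * ∫ u in 𝓕, F g * (φ ((u : GL (Fin n) (AdeleRing (𝓞 K) K)) * g) * χ u) ∂ν₀ := by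
    intro g
    rw [whittakerCoeff_def, integral_const_mul, Complex.real_smul, ← hc]
    ring
  simp_rw [hstep1]
  rw [integral_const_mul]
  -- Step 2: Fubini.
  set f₁ : GL (Fin n) (AdeleRing (𝓞 K) K) → ↥(adelicUnipotent n K) → ℂ :=
    fun g u => F g * (φ ((u : GL (Fin n) (AdeleRing (𝓞 K) K)) * g) * χ u) with hf₁
  obtain ⟨M₁, hM₁⟩ := (hC𝓕c.mul hDc).exists_bound_of_continuousOn hφ.continuousOn
  have hf₁i : Integrable (uncurry f₁) (νG.prod (ν₀.restrict 𝓕)) := by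
    have hcont : Continuous (uncurry f₁) :=
      (hF.comp continuous_fst).mul
        ((hφ.comp ((hcoe.comp continuous_snd).mul continuous_fst)).mul (hχc.comp continuous_snd))
    refine Integrable.mono' ((hF.norm.integrable_of_hasCompactSupport hFs.norm).const_mul
        (max M₁ 0) |>.mul_prod (integrable_const (1 : ℝ))) hcont.aestronglyMeasurable ?_
    have hae : ∀ᵐ p ∂(νG.prod (ν₀.restrict 𝓕)), p.2 ∈ 𝓕 := by
      have : νG.prod (ν₀.restrict 𝓕) = (νG.prod ν₀).restrict (Set.univ ×ˢ 𝓕) := by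
        rw [← Measure.prod_restrict, Measure.restrict_univ]
      rw [this]
      filter_upwards [ae_restrict_mem (MeasurableSet.univ.prod h𝓕m)] with p hp using hp.2
    filter_upwards [hae] with p hp
    simp only [uncurry, hf₁, mul_one]
    by_cases hg : p.1 ∈ D
    · have hmem : (p.2 : GL (Fin n) (AdeleRing (𝓞 K) K)) * p.1 ∈ C𝓕 * D :=
        Set.mul_mem_mul ⟨p.2, subset_closure hp, rfl⟩ hg
      rw [norm_mul, norm_mul, hχ1, mul_one, mul_comm]
      refine mul_le_mul ((hM₁ _ hmem).trans (le_max_left _ _)) le_rfl (norm_nonneg _)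
        (le_max_right _ _)
    · have : F p.1 = 0 := image_eq_zero_of_notMem_tsupport hg
      simp [this]
  have hswap1 : ∫ g, ∫ u in 𝓕, f₁ g u ∂ν₀ ∂νG = ∫ u in 𝓕, ∫ g, f₁ g u ∂νG ∂ν₀ :=
    integral_integral_swap hf₁i
  rw [show (fun g => ∫ u in 𝓕, F g * (φ ((u : GL (Fin n) (AdeleRing (𝓞 K) K)) * g) * χ u) ∂ν₀) =
      fun g => ∫ u in 𝓕, f₁ g u ∂ν₀ from rfl, hswap1]
  -- Step 3: left invariance in the inner integral.
  set f₂ : ↥(adelicUnipotent n K) → GL (Fin n) (AdeleRing (𝓞 K) K) → ℂ :=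
    fun u g => F ((u : GL (Fin n) (AdeleRing (𝓞 K) K))⁻¹ * g) * (φ g * χ u) with hf₂
  have hinner : ∀ u, ∫ g, f₁ g u ∂νG = ∫ g, f₂ u g ∂νG := by
    intro u
    have := integral_mul_left_eq_self (μ := νG) (f₂ u) (u : GL (Fin n) (AdeleRing (𝓞 K) K))
    rw [← this]
    congr 1 with g
    simp only [hf₁, hf₂, inv_mul_cancel_left]
  simp_rw [hinner]
  -- Step 4: Fubini back.
  obtain ⟨M₂, hM₂⟩ := (hC𝓕c.mul hDc).exists_bound_of_continuousOn hφ.continuousOn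
  have hD₂c : IsCompact (C𝓕 * D) := hC𝓕c.mul hDc
  haveI : T2Space (GL (Fin n) (AdeleRing (𝓞 K) K)) := t2Space_gl n K
  have hf₂i : Integrable (uncurry f₂) ((ν₀.restrict 𝓕).prod νG) := by
    have hcont : Continuous (uncurry f₂) :=
      (hF.comp (((hcoe.comp continuous_fst).inv).mul continuous_snd)).mul
        ((hφ.comp continuous_snd).mul (hχc.comp continuous_fst))
    have hind : Integrable ((C𝓕 * D).indicator fun _ => (MF * max M₂ 0 : ℝ)) νG :=
      (integrableOn_const (hD₂c.measure_lt_top.ne)).integrable_indicator hD₂c.isClosed.measurableSet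
    refine Integrable.mono' ((integrable_const (1 : ℝ)).mul_prod hind) hcont.aestronglyMeasurable ?_
    have hae : ∀ᵐ p ∂((ν₀.restrict 𝓕).prod νG), p.1 ∈ 𝓕 := by
      have : (ν₀.restrict 𝓕).prod νG = (ν₀.prod νG).restrict (𝓕 ×ˢ Set.univ) := by
        rw [← Measure.prod_restrict, Measure.restrict_univ]
      rw [this]
      filter_upwards [ae_restrict_mem (h𝓕m.prod MeasurableSet.univ)] with p hp using hp.1
    filter_upwards [hae] with p hp
    simp only [uncurry, hf₂, one_mul]
    by_cases hg : p.2 ∈ C𝓕 * D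
    · rw [indicator_of_mem hg, norm_mul, norm_mul, hχ1, mul_one]
      exact mul_le_mul (hMF _) ((hM₂ _ hg).trans (le_max_left _ _)) (norm_nonneg _) hMF0
    · have hF0 : F ((p.1 : GL (Fin n) (AdeleRing (𝓞 K) K))⁻¹ * p.2) = 0 := by
        by_contra hne
        apply hg
        refine ⟨p.1, ⟨p.1, subset_closure hp, rfl⟩,
          (p.1 : GL (Fin n) (AdeleRing (𝓞 K) K))⁻¹ * p.2, subset_tsupport _ hne, ?_⟩
        simp
      rw [indicator_of_notMem hg, hF0, zero_mul, norm_zero]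
  have hswap2 : ∫ u in 𝓕, ∫ g, f₂ u g ∂νG ∂ν₀ = ∫ g, ∫ u in 𝓕, f₂ u g ∂ν₀ ∂νG :=
    integral_integral_swap hf₂i
  rw [hswap2, ← integral_const_mul]
  congr 1 with g
  simp only [hf₂, whittakerTransform, Complex.real_smul, ← hc]
  rw [mul_assoc, ← integral_mul_const, ← integral_const_mul, ← integral_const_mul]
  congr 1 with u
  simp only [hχ]
  ring

/-- The Whittaker transform of a test function is supported in `closure(𝓕) · supp F`. [folklore] -/
theorem whittakerTransform_eq_zero_of_notMem (ν₀ : Measure ↥(adelicUnipotent n K))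
    (𝓕 : Set ↥(adelicUnipotent n K)) (ψ : AddChar (AdeleRing (𝓞 K) K) Circle)
    (F : GL (Fin n) (AdeleRing (𝓞 K) K) → ℂ) {h : GL (Fin n) (AdeleRing (𝓞 K) K)}
    (hh : h ∉ ((fun u : ↥(adelicUnipotent n K) => (u : GL (Fin n) (AdeleRing (𝓞 K) K))) ''
      closure 𝓕) * tsupport F) :
    whittakerTransform ν₀ 𝓕 ψ F h = 0 := by
  unfold whittakerTransform
  rw [setIntegral_eq_zero_of_forall_eq_zero fun u hu => ?_, smul_zero]
  have : F ((u : GL (Fin n) (AdeleRing (𝓞 K) K))⁻¹ * h) = 0 := by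
    by_contra hne
    exact hh ⟨u, ⟨u, subset_closure hu, rfl⟩, (u : GL (Fin n) (AdeleRing (𝓞 K) K))⁻¹ * h,
      subset_tsupport _ hne, by simp⟩
  rw [this, zero_mul]

/-- The Whittaker transform of a test function has compact support. [folklore] -/
theorem hasCompactSupport_whittakerTransform (ν₀ : Measure ↥(adelicUnipotent n K))
    {𝓕 : Set ↥(adelicUnipotent n K)} (h𝓕c : IsCompact (closure 𝓕))
    (ψ : AddChar (AdeleRing (𝓞 K) K) Circle) {F : GL (Fin n) (AdeleRing (𝓞 K) K) → ℂ}
    (hFs : HasCompactSupport F) : HasCompactSupport (whittakerTransform ν₀ 𝓕 ψ F) := by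
  refine HasCompactSupport.intro ((h𝓕c.image continuous_subtype_val).mul hFs) fun h hh => ?_
  exact whittakerTransform_eq_zero_of_notMem ν₀ 𝓕 ψ F hh

/-- The Whittaker transform of a test function is continuous (dominated convergence on the finite
measure `ν₀|_𝓕`). [folklore] -/
theorem continuous_whittakerTransform [SecondCountableTopology (GL (Fin n) (AdeleRing (𝓞 K) K))]
    (ν₀ : Measure ↥(adelicUnipotent n K)) {𝓕 : Set ↥(adelicUnipotent n K)} (h𝓕f : ν₀ 𝓕 < ∞)
    {ψ : AddChar (AdeleRing (𝓞 K) K) Circle} (hψ : Continuous ψ)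
    {F : GL (Fin n) (AdeleRing (𝓞 K) K) → ℂ} (hF : Continuous F) (hFs : HasCompactSupport F) :
    Continuous (whittakerTransform ν₀ 𝓕 ψ F) := by
  haveI : IsFiniteMeasure (ν₀.restrict 𝓕) := isFiniteMeasure_restrict.2 h𝓕f.ne
  obtain ⟨MF, hMF⟩ := hF.bounded_above_of_compact_support hFs
  unfold whittakerTransform
  refine (?_ : Continuous fun h => ∫ u in 𝓕, F ((u : GL (Fin n) (AdeleRing (𝓞 K) K))⁻¹ * h) *
    conj (whittakerCharFun ψ u) ∂ν₀).const_smul ((ν₀ 𝓕).toReal⁻¹ : ℝ)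
  refine continuous_of_dominated (bound := fun _ => MF) ?_ ?_ (integrable_const _) ?_
  · intro h
    exact ((hF.comp (continuous_subtype_val.inv.mul continuous_const)).mul
      (Complex.continuous_conj.comp (continuous_whittakerCharFun hψ))).aestronglyMeasurable
  · intro h
    refine Eventually.of_forall fun u => ?_
    rw [norm_mul, norm_conj_whittakerCharFun, mul_one]
    exact hMF _
  · refine Eventually.of_forall fun u => ?_
    exact (hF.comp (continuous_const.mul continuous_id)).mul continuous_const

end WhittakerUnfold

end Literature.NumberTheory.Automorphic
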